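import Literature.NumberTheory.EllipticCurves.ModularSymbolsEichlerShimuraHoldsProofs
import Literature.NumberTheory.EllipticCurves.PAdicLFunctionDistributionHoldsProofs
import Literature.NumberTheory.EllipticCurves.PAdicLFunctionIntegralityAtTwoAutoProofs
import Literature.NumberTheory.EllipticCurves.CuspFormLFunctionLevelConductorProofs
import Literature.NumberTheory.EllipticCurves.NoConductorOne
import Literature.NumberTheory.EllipticCurves.LambdaInvariantCongruenceTransportAtTwo
import HarnessLib

/-!
# Route `EisensteinDepletionAtTwo`, crux E1M `DepletedLambdaLawAtTwoMod` (stmt-BirchSwinnertonDyer-20341), line `star`: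
# (★-PlusPrimitive) — the plus functional `[b/d]⁺ − [0]⁺` of a newform has the GLOBAL primitive scale `½`

Cell `bsd-rank2` (HOME run/shared/lean/pub/bsd-rank2/), lead `bsd-rank2-star-p1` GEN 3 (helper `--supports` the crux item; skeleton
`Cruxes/DepletedLambdaLawAtTwoMod/Lines/star.lean` v3.8, stub `stub_starPlusPrimitive`; eng GEN 10 landed the level-`N` form
`…StarPlusPrimitive.lean` (`exists_odd_plusCusp`, conditional on `N = N_W` or squarefree `N_W`) minutes earlier — this file is the
UNCONDITIONAL closer: coprimality is transferred from `N_W` to the level through the common prime factors). For an elliptic `W/ℚ` (globally minimal) and a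
newform `f` of `W` (level `N`): on the cusps `b/d` with `d > 0`, `gcd(d, bN_W) = 1`, the differences `[b/d]⁺_f − [0]⁺_f` are
HALF-INTEGERS (`exists_ratPlusSymbol_eq_add_div_two`; `gcd(d, N) = 1` because the level and the conductor have the same primes,
`IsNewformOf.dvd_level_iff_dvd_conductorNorm`), and ONE of them is an ODD multiple of `½`: by Eichler–Shimura (tree theorem
`isZLattice_periodLattice_holds`) `re Λ_f = ℤ·Ω⁺/2` with `Ω⁺ > 0` (`plusPeriod_pos_and_realPeriods_eq`), `Λ_f` is generated by the cusp
periods `{∞, γ∞}`, so some `γ = (a b; c d) ∈ Γ₀(N)` has `2 re{∞, γ∞}/Ω⁺` odd, and Manin's relation (`modularSymbol_gamma0_smul_holds`,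
at `r = 0`) gives `{∞, γ∞} = {∞, b/d} − {∞, 0}`, i.e. `[b/d]⁺ − [0]⁺ = re{∞, γ∞}/Ω⁺` (`plusSymbol_eq_re_of`, `ratCast_ratPlusSymbol_holds`);
`d ≠ 0` because `N ≠ 1` (`N_W ≠ 1`, Tate, `conductorNorm_ne_one`). The habitat hypotheses of the stub are not used.

THEOREMS ONLY; no `sorry`; standard axioms. PARTITION: none — r_an ≥ 2, summit axis S0; TWIN (D-0056): n/a. B1 honesty: period-lattice
bookkeeping for one newform; nothing reads an analytic rank; (★-SymbC)/(★)/E1M/BSD are NOT proved by this.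

References: G. Shimura, *Introduction to the Arithmetic Theory of Automorphic Functions* (1971) Thm. 7.14 [Shimura1971]; Ju. I. Manin,
*Izv. AN SSSR* 36 (1972) Prop. 1.4, Thm. 1.6 [Manin1972]; J. E. Cremona, *Algorithms for modular elliptic curves* (1997) §2.8
[CremonaAlgorithms1997]; B. Mazur, J. Tate, J. Teitelbaum, *Invent. Math.* 84 (1986) §I.8 [MazurTateTeitelbaum1986Invent].
-/

set_option linter.dupNamespace false
set_option autoImplicit false

noncomputable section

open scoped MatrixGroups ModularForm

open CongruenceSubgroup Literature.NumberTheory.EllipticCurves Literature.NumberTheory.EllipticCurves.ModularForms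
  Literature.NumberTheory.EllipticCurves.Greenberg1999

namespace Summit.BirchSwinnertonDyer.BirchSwinnertonDyer.Theorems.DepletionAtTwo

/-- **An odd cusp period.** For a normalised rational newform `f ∈ S₂(Γ₀(N))` some `γ ∈ Γ₀(N)` has
`re{∞, γ∞}_f = k·Ω⁺_f/2` with `k` ODD (Eichler–Shimura: `re Λ_f = ℤ·Ω⁺/2`, and `Λ_f` is generated by the cusp periods).
[cite: Shimura1971, Thm. 7.14] [cite: CremonaAlgorithms1997, §2.8] -/
theorem exists_cuspSymbol_re_odd {N : ℕ} [NeZero N] {f : CuspForm (Gamma0 N) 2} (hf : IsNewform0 f)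
    (hQ : coeffField f = ⊥) :
    ∃ (γ : Gamma0 N) (k : ℤ), Odd k ∧ (cuspSymbol f γ).re = k * (plusPeriod f / 2) := by
  obtain ⟨hpos, hre⟩ := plusPeriod_pos_and_realPeriods_eq (isZLattice_periodLattice_holds (f := f)) hf hQ
  set Ω := plusPeriod f with hΩ
  have hint : ∀ z ∈ periodLattice f, ∃ k : ℤ, z.re = k * (Ω / 2) := by
    intro z hz
    have hz' : z.re ∈ realPeriods f := by
      rw [realPeriods, AddSubgroup.mem_map]
      exact ⟨z, hz, rfl⟩
    rw [hre, AddSubgroup.mem_zmultiples_iff] at hz'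
    obtain ⟨k, hk⟩ := hz'
    exact ⟨k, by rw [← hk, zsmul_eq_mul]⟩
  by_contra hno
  push Not at hno
  have heven : ∀ z ∈ periodLattice f, ∃ k : ℤ, Even k ∧ z.re = k * (Ω / 2) := by
    intro z hz
    induction hz using AddSubgroup.closure_induction with
    | mem y hy =>
      obtain ⟨γ, rfl⟩ := hy
      obtain ⟨k, hk⟩ := hint _ (AddSubgroup.subset_closure ⟨γ, rfl⟩)
      rcases Int.even_or_odd k with he | ho
      · exact ⟨k, he, hk⟩
      · exact absurd hk (hno γ k ho)
    | zero => exact ⟨0, ⟨0, rfl⟩, by simp⟩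
    | add y z _ _ ihy ihz =>
      obtain ⟨k₁, hk₁, e₁⟩ := ihy
      obtain ⟨k₂, hk₂, e₂⟩ := ihz
      exact ⟨k₁ + k₂, hk₁.add hk₂, by rw [Complex.add_re, e₁, e₂]; push_cast; ring⟩
    | neg y _ ih =>
      obtain ⟨k, hk, e⟩ := ih
      exact ⟨-k, hk.neg, by rw [Complex.neg_re, e]; push_cast; ring⟩
  have hmem : Ω / 2 ∈ realPeriods f := by rw [hre]; exact AddSubgroup.mem_zmultiples _
  rw [realPeriods, AddSubgroup.mem_map] at hmem
  obtain ⟨z, hz, hzre⟩ := hmem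
  obtain ⟨k, hk, e⟩ := heven z hz
  have hzre' : z.re = Ω / 2 := hzre
  have hk1 : (k : ℝ) = 1 := by
    have h2 : (k : ℝ) * (Ω / 2) = 1 * (Ω / 2) := by rw [← e, hzre', one_mul]
    exact mul_right_cancel₀ (by positivity) h2
  have : k = 1 := by exact_mod_cast hk1
  rw [this] at hk
  exact Int.not_even_one hk

/-- **Half-integrality and an odd value of the plus functional** for a newform `f` of an elliptic `W/ℚ`: with `g = ½`, every
`[b/d]⁺_f − [0]⁺_f` (`d > 0`, `gcd(d, bN_W) = 1`) is an integer multiple of `g`, and one of them is an ODD multiple.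
[cite: MazurTateTeitelbaum1986Invent, §I.8] [cite: Manin1972, Prop. 1.4, Thm. 1.6] [cite: Shimura1971, Thm. 7.14] -/
theorem plusFunctional_halfIntegral_and_odd (W : WeierstrassCurve ℚ) [W.IsElliptic] [W.IsGloballyMinimal]
    {N : ℕ} [NeZero N] (f : CuspForm (Gamma0 N) 2) (hf : IsNewformOf W f) :
    (∀ b d : ℤ, 0 < d → Int.gcd d (b * (W.conductorNorm ℤ : ℕ)) = 1 →
        ∃ n : ℤ, ratPlusSymbol f ((b : ℚ) / (d : ℚ)) - ratPlusSymbol f 0 = n * (1 / 2 : ℚ)) ∧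
      (∃ b d : ℤ, 0 < d ∧ Int.gcd d (b * (W.conductorNorm ℤ : ℕ)) = 1 ∧
        ∃ n : ℤ, ratPlusSymbol f ((b : ℚ) / (d : ℚ)) - ratPlusSymbol f 0 = n * (1 / 2 : ℚ) ∧ Odd n) := by
  set M : ℕ := W.conductorNorm ℤ with hM
  have hQ := hf.coeffField_eq_bot
  have hreal : ∀ n, (cuspCoeff f n).im = 0 := cuspCoeff_im_eq_zero_of_coeffField_eq_bot hQ
  -- a prime divides the level iff it divides the conductor
  have hprime : ∀ p : ℕ, p.Prime → (p ∣ N ↔ p ∣ M) := fun p hp ↦ hf.dvd_level_iff_dvd_conductorNorm hp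
  constructor
  · intro b d hd hcop
    have hx : Nat.Coprime (((b : ℚ) / (d : ℚ))).den N := by
      apply Nat.Coprime.symm
      apply Nat.coprime_of_dvd
      intro p hp hpN hpden
      have hpM : p ∣ M := (hprime p hp).mp hpN
      have hden : ((((b : ℚ) / (d : ℚ))).den : ℤ) ∣ d := by
        rw [← Rat.divInt_eq_div]; exact Rat.den_dvd b d
      have hpd : (p : ℤ) ∣ d := (Int.natCast_dvd_natCast.mpr hpden).trans hden
      have hpbM : (p : ℤ) ∣ b * (M : ℕ) := Dvd.dvd.mul_left (Int.natCast_dvd_natCast.mpr hpM) b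
      have h1 : (p : ℤ) ∣ (Int.gcd d (b * (M : ℕ)) : ℤ) := Int.dvd_coe_gcd hpd hpbM
      rw [hcop] at h1
      exact hp.one_lt.ne' (by exact_mod_cast Int.eq_one_of_dvd_one (by positivity) h1)
    obtain ⟨k, hk⟩ := exists_ratPlusSymbol_eq_add_div_two f hreal hx
    exact ⟨k, by rw [hk]; ring⟩
  · -- the odd witness from an odd cusp period
    obtain ⟨γ, k, hk, hγ⟩ := exists_cuspSymbol_re_odd hf.1 hQ
    obtain ⟨hpos, -⟩ := plusPeriod_pos_and_realPeriods_eq (isZLattice_periodLattice_holds (f := f)) hf.1 hQ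
    set A : SL(2, ℤ) := (γ : SL(2, ℤ)) with hA
    have hdet : A 0 0 * A 1 1 - A 0 1 * A 1 0 = 1 := by
      have := Matrix.SpecialLinearGroup.det_coe A
      rwa [Matrix.det_fin_two] at this
    have hNc : (N : ℤ) ∣ A 1 0 := by
      have h := Gamma0_mem.mp γ.2
      exact (ZMod.intCast_zmod_eq_zero_iff_dvd _ N).mp h
    -- `c ≠ 0`: otherwise the cusp period vanishes
    have hc : A 1 0 ≠ 0 := by
      intro hc
      have h0 : cuspSymbol f γ = 0 := by simp only [cuspSymbol, ← hA, hc, if_true]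
      rw [h0, Complex.zero_re] at hγ
      have : (k : ℝ) = 0 := by
        have h2 : (k : ℝ) * (plusPeriod f / 2) = 0 * (plusPeriod f / 2) := by rw [← hγ, zero_mul]
        exact mul_right_cancel₀ (by positivity) h2
      have hk0 : k = 0 := by exact_mod_cast this
      rw [hk0] at hk; exact absurd hk (by decide)
    -- `d ≠ 0`: otherwise `c = ±1`, `N = 1`, and the conductor would be `1`
    have hd : A 1 1 ≠ 0 := by
      intro hd0
      rw [hd0, mul_zero, zero_sub] at hdet
      have hc1 : A 1 0 ∣ 1 := ⟨-A 0 1, by linear_combination -hdet⟩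
      have hN1 : (N : ℤ) ∣ 1 := hNc.trans hc1
      have hN1' : N = 1 := by exact_mod_cast Int.eq_one_of_dvd_one (by positivity) hN1
      have hM1 : M ≠ 1 := W.conductorNorm_ne_one
      have hM0 : M ≠ 0 := (W.conductorNorm_pos_holds).ne'
      obtain ⟨p, hp, hpM⟩ := Nat.exists_prime_and_dvd hM1
      have : p ∣ N := (hprime p hp).mpr hpM
      rw [hN1'] at this
      exact hp.one_lt.ne' (Nat.dvd_one.mp this)
    -- Manin's relation at `r = 0`: `{∞, b/d} = {∞, γ∞} + {∞, 0}`
    have hmanin := modularSymbol_gamma0_smul_holds f γ 0 (by rw [mul_zero, zero_add]; exact_mod_cast hd)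
    rw [mul_zero, zero_add, mul_zero, zero_add] at hmanin
    -- real parts and the rational plus symbols
    have hrat : ∀ r : ℚ, ((ratPlusSymbol f r : ℚ) : ℝ) = (modularSymbol f r).re / plusPeriod f := fun r ↦ by
      rw [ratCast_ratPlusSymbol_holds hf.1 hQ r, normalizedPlusSymbol,
        plusSymbol_eq_re_of f (modularSymbol_neg_eq_conj_holds (f := f)) hreal r, Complex.ofReal_re]
    have hval : ratPlusSymbol f (((A 0 1 : ℤ) : ℚ) / ((A 1 1 : ℤ) : ℚ)) - ratPlusSymbol f 0 = k * (1 / 2 : ℚ) := by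
      apply Rat.cast_injective (α := ℝ)
      push_cast
      rw [hrat, hrat, ← sub_div, hmanin, Complex.add_re, add_sub_cancel_right, ← hA] at *
      rw [hγ]
      field_simp
    -- `gcd(d, bN_W) = 1`
    have hcopd : Int.gcd (A 1 1) (A 0 1 * (M : ℕ)) = 1 := by
      apply Int.isCoprime_iff_gcd_eq_one.mp
      refine IsCoprime.mul_right ⟨A 0 0, -A 1 0, by linear_combination hdet⟩ ?_
      rw [Int.isCoprime_iff_gcd_eq_one]
      by_contra hg
      obtain ⟨p, hp, hpg⟩ := Nat.exists_prime_and_dvd hg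
      have hpd : (p : ℤ) ∣ A 1 1 := (Int.natCast_dvd_natCast.mpr hpg).trans (Int.gcd_dvd_left _ _)
      have hpM : (p : ℤ) ∣ ((M : ℕ) : ℤ) := (Int.natCast_dvd_natCast.mpr hpg).trans (Int.gcd_dvd_right _ _)
      have hpN : p ∣ N := (hprime p hp).mpr (by exact_mod_cast hpM)
      have hpc : (p : ℤ) ∣ A 1 0 := (Int.natCast_dvd_natCast.mpr hpN).trans hNc
      have h1 : (p : ℤ) ∣ 1 := by
        have : (p : ℤ) ∣ A 0 0 * A 1 1 - A 0 1 * A 1 0 := (hpd.mul_left _).sub (hpc.mul_left _)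
        rwa [hdet] at this
      exact hp.one_lt.ne' (by exact_mod_cast Int.eq_one_of_dvd_one (by positivity) h1)
    -- normalise the sign of `d`
    rcases lt_or_gt_of_ne hd with hneg | hposd
    · refine ⟨-A 0 1, -A 1 1, by linarith, by rwa [neg_mul, Int.neg_gcd, Int.gcd_neg], k, ?_, hk⟩
      push_cast
      rw [neg_div_neg_eq]
      exact hval
    · exact ⟨A 0 1, A 1 1, hposd, hcopd, k, hval, hk⟩

/-- **(★-PlusPrimitive)** — the registered stub `stub_starPlusPrimitive` of line `star` (skeleton v3.8), BY NAME after
`unfold StarPlusPrimitive plusAt`: for every habitat curve `W` and newform `f` of `W` the plus functional has a global primitive scale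
(`g = ½`). The habitat hypotheses are not used. [cite: Shimura1971, Thm. 7.14] [cite: Manin1972, Prop. 1.4, Thm. 1.6] -/
theorem star_plusPrimitive :
    ∀ (W : WeierstrassCurve ℚ) [W.IsElliptic] [W.IsGloballyMinimal] (x : ℚ), IsOrdinaryAt W 2 →
      HasUniqueRationalTwoTorsionX W x →
      ((TwoTorsionRamifiedAtTwo x ∧ ¬ TwoTorsionOdd W x) ∨ (TwoTorsionOdd W x ∧ ¬ TwoTorsionRamifiedAtTwo x)) →
      ∀ ⦃N : ℕ⦄ [NeZero N] (f : CuspForm (Gamma0 N) 2), IsNewformOf W f →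
        ∃ g : ℚ, g ≠ 0 ∧
          (∀ b d : ℤ, 0 < d → Int.gcd d (b * (W.conductorNorm ℤ : ℕ)) = 1 →
            ∃ n : ℤ, ratPlusSymbol f ((b : ℚ) / (d : ℚ)) - ratPlusSymbol f 0 = n * g) ∧
          (∃ b d : ℤ, 0 < d ∧ Int.gcd d (b * (W.conductorNorm ℤ : ℕ)) = 1 ∧
            ∃ n : ℤ, ratPlusSymbol f ((b : ℚ) / (d : ℚ)) - ratPlusSymbol f 0 = n * g ∧ Odd n) := by
  intro W _ _ _ _ _ _ N _ f hf
  exact ⟨1 / 2, by norm_num, plusFunctional_halfIntegral_and_odd W f hf⟩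

end Summit.BirchSwinnertonDyer.BirchSwinnertonDyer.Theorems.DepletionAtTwo

end
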